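import Summits.NavierStokesRegularity.FluidComputer.ClayBlowupRows
import Summits.NavierStokesRegularity.FluidComputer.DesignedBlowupNotSelfSimilar
import HarnessLib

/-!
# NO Clay blow-up is an exact collapse ansatz `(T−t)^{γ−1} U(x/(T−t)^γ)`, `γ ≠ ½`, near its lifespan
# (row R7′ of the compatibility list BY NAME on the weak type, any pressure, no named fact)

Cell `ns-blowup`, seat `ns-blowup-ecbridge-2` (g5; the E–C endpoint theory seat). LABEL: E–C typing
(KERNEL — no named fact). WHAT THIS IS NOT: not Navier–Stokes evidence — a necessary condition on the
TYPE `ClayBlowup` (no inhabitant is claimed anywhere), hence on every breakdown scenario for (C).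
Companion memo: `run/shared/lean/pub/ns-blowup/ecbridge2/ECBRIDGE-2-MEMO-4.md` §2 (R7′).

## Content

Seat g4 proved the collapse obstruction on the strong type (`DesignedBlowupNotSelfSimilar.lean`:
a `DesignedBlowup` coinciding with `selfSimilarCollapse γ T U` on `(t₁, T) × ℝ³`, `γ ≠ ½`, `γ > −½`,
`U ∈ C³` divergence free, has `U = 0` and is «not unbounded on compact boxes»). On the WEAK type the
conclusion sharpens to a CONTRADICTION, because the `L^∞` criterion `ClayBlowup.velocity_unbounded`
is now kernel:

* `ClayBlowup.profile_eq_zero_of_eq_selfSimilarCollapse` — the profile is trivial (the Clay force is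
  the ansatz's residual with the blow-up's own pressure, its curl is bounded; g4's two-scale lemma
  `CollapseAnsatz.profile_eq_zero`; `U ∈ L²` from the slice energy and `curl U ∈ L²` from Tao's class,
  both fact-free);
* **`ClayBlowup.false_of_eq_selfSimilarCollapse`** — hence `u ≡ 0` on `(t₁, T)`, so `u` is bounded on
  `[0, T)`: contradiction. NO CLAY BLOW-UP (`ν > 0`) IS AN EXACT COLLAPSE ANSATZ WITH `γ ≠ ½`, `γ > −½`
  NEAR ITS LIFESPAN, whatever its pressure; `DesignedBlowup.false_of_eq_selfSimilarCollapse` — the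
  strong type. (The case `γ = ½` — Leray's ansatz, as a PAIR — is `ClayBlowupNotLeraySelfSimilar.lean`.)

References: P. Constantin, M. Ignatova, V. Vicol, arXiv 2026, §3.1 [cite: ConstantinIgnatovaVicol2026Putative, §3.1];
C. L. Fefferman, Clay problem description, (C) (5) [cite: FeffermanClay2006, (C) (5)]; T. Tao, Anal.
PDE 6 (2013), Cor. 11.1 [cite: Tao2011, Cor. 11.1].
-/

noncomputable section

namespace Summit.NavierStokesRegularity.FluidComputer

open Set MeasureTheory Filter Topology Function Laplacian
open scoped ENNReal ContDiff NNReal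
open Literature.Analysis.FluidPDE
open Summit.NavierStokesRegularity.NavierStokesRegularity

namespace ClayBlowup

variable {ν γ t₁ : ℝ} (X : ClayBlowup ν) {U : EuclideanSpace ℝ (Fin 3) → EuclideanSpace ℝ (Fin 3)}

/-- **The force of a Clay blow-up that coincides with an exact collapse ansatz IS the ansatz's
residual** (with the blow-up's own pressure), on `(t₁, T) × ℝ³`, `0 ≤ t₁`. [cite: FeffermanClay2006, (C)] -/
theorem force_eq_residual_selfSimilarCollapse (ht₁ : 0 ≤ t₁)
    (heq : ∀ t ∈ Ioo t₁ X.T, ∀ x, X.u t x = selfSimilarCollapse γ X.T U t x) :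
    ∀ t ∈ Ioo t₁ X.T, ∀ x, X.f t x =
      timeDeriv (selfSimilarCollapse γ X.T U) t x +
        convect (selfSimilarCollapse γ X.T U t) (selfSimilarCollapse γ X.T U t) x -
        ν • (Δ (selfSimilarCollapse γ X.T U t)) x + gradient (X.p t) x := by
  intro t ht x
  have hslice : X.u t = selfSimilarCollapse γ X.T U t := funext fun y => heq t ht y
  rw [X.classical.force_eq_nsResidual t ⟨ht₁.trans ht.1.le, ht.2⟩ x, nsResidual_apply,
    timeDerivWithin_Ico_eq_timeDeriv_of_eqOn ht₁ ht heq x, hslice]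

/-- **`U ∈ L²` and `curl U ∈ L²` for free** (`ν > 0`): the slice at `t₀ = (t₁ + T)/2` has finite
energy (structure) and finite enstrophy (Tao's class on `[0, t₀]`, `hasBoundedSobolevNormsOn`).
[cite: Tao2011, Cor. 11.1] -/
theorem memLp_two_profile_and_curl_of_eq_selfSimilarCollapse (hν : 0 < ν) (ht₁ : 0 ≤ t₁)
    (ht₁T : t₁ < X.T) (hU : ContDiff ℝ 3 U)
    (heq : ∀ t ∈ Ioo t₁ X.T, ∀ x, X.u t x = selfSimilarCollapse γ X.T U t x) :
    MemLp U 2 volume ∧ MemLp (curl U) 2 volume := by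
  set t₀ : ℝ := (t₁ + X.T) / 2 with ht₀
  have ht₀I : t₀ ∈ Ioo t₁ X.T := ⟨by rw [ht₀]; linarith, by rw [ht₀]; linarith⟩
  have ht₀0 : 0 < t₀ := lt_of_le_of_lt ht₁ ht₀I.1
  have hslice : X.u t₀ = selfSimilarCollapse γ X.T U t₀ := funext fun x => heq t₀ ht₀I x
  obtain ⟨C, hCt, hC⟩ := X.energy t₀ ht₀I.2
  have h2 : MemLp (X.u t₀) 2 volume :=
    memLp_two_of_lintegral_lt_top (X.classical.contDiff_velocity ⟨ht₀0.le, ht₀I.2⟩).continuous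
      ((hC t₀ ⟨ht₀0.le, le_rfl⟩).trans_lt hCt)
  rw [hslice] at h2
  obtain ⟨C₁, hC₁⟩ := X.hasBoundedSobolevNormsOn hν ht₀0 ht₀I.2 1
  have hD : ∫⁻ x, ‖iteratedFDeriv ℝ 1 (selfSimilarCollapse γ X.T U t₀) x‖ₑ ^ 2 < ⊤ := by
    rw [← hslice]
    exact (hC₁ t₀ ⟨ht₀0.le, le_rfl⟩).trans_lt ENNReal.coe_lt_top
  exact ⟨DesignedBlowup.memLp_two_profile_of_selfSimilarCollapse ht₀I.2 hU.continuous h2,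
    DesignedBlowup.memLp_two_curl_profile_of_selfSimilarCollapse ht₀I.2 (hU.of_le (by norm_cast)) hD⟩

/-- **A Clay blow-up which is an exact collapse ansatz near `T` has a trivial profile** (`ν > 0`,
`γ ≠ ½`, `γ > −½`, `0 ≤ t₁ < T`, `U ∈ C³` divergence free; no integrability hypothesis, no named fact):
the Clay force is the residual, its curl is bounded (`CollapseAnsatz.clayForce_curl_bounded`), and
g4's two-scale lemma `CollapseAnsatz.profile_eq_zero` applies with `U, curl U ∈ L²`.
[cite: ConstantinIgnatovaVicol2026Putative, §3.1] [cite: FeffermanClay2006, (C) (5)] -/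
theorem profile_eq_zero_of_eq_selfSimilarCollapse (hν : 0 < ν) (hγ : γ ≠ 1 / 2)
    (hγ' : -(1 / 2) < γ) (ht₁ : 0 ≤ t₁) (ht₁T : t₁ < X.T) (hU : ContDiff ℝ 3 U)
    (hdiv : VectorCalculus.IsDivFree U)
    (heq : ∀ t ∈ Ioo t₁ X.T, ∀ x, X.u t x = selfSimilarCollapse γ X.T U t x) : U = 0 := by
  obtain ⟨hU2, hω2⟩ := X.memLp_two_profile_and_curl_of_eq_selfSimilarCollapse hν ht₁ ht₁T hU heq
  have hq : ∀ t ∈ Ioo t₁ X.T, ContDiff ℝ 2 (X.p t) := fun t ht =>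
    (X.classical.contDiff_pressure ⟨ht₁.trans ht.1.le, ht.2⟩).of_le (by norm_cast)
  obtain ⟨M, hM⟩ := CollapseAnsatz.clayForce_curl_bounded X.force_smooth X.force_decay
  have hres := X.force_eq_residual_selfSimilarCollapse ht₁ heq
  refine CollapseAnsatz.profile_eq_zero hγ hγ' hν.ne' ht₁T hU hdiv hq (M := M) ?_ (p := 2)
    (by norm_num) ENNReal.ofNat_ne_top hω2 (r := 2) (by norm_num) ENNReal.ofNat_ne_top hU2
  intro t ht x
  have hfun : (fun z => timeDeriv (selfSimilarCollapse γ X.T U) t z +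
      convect (selfSimilarCollapse γ X.T U t) (selfSimilarCollapse γ X.T U t) z -
      ν • (Δ (selfSimilarCollapse γ X.T U t)) z + gradient (X.p t) z) = X.f t :=
    funext fun z => (hres t ht z).symm
  rw [hfun]
  exact hM t (ht₁.trans ht.1.le) x

/-- **NO CLAY BLOW-UP IS AN EXACT COLLAPSE ANSATZ (`γ ≠ ½`) NEAR ITS LIFESPAN** (`ν > 0`; no named
fact, any pressure): with the trivial profile the velocity vanishes on `(t₁, T)`, so it is bounded on
`[0, T)` — against `velocity_unbounded`. [cite: FeffermanClay2006, (C) (5)]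
[cite: ConstantinIgnatovaVicol2026Putative, §3.1] -/
theorem false_of_eq_selfSimilarCollapse (hν : 0 < ν) (hγ : γ ≠ 1 / 2) (hγ' : -(1 / 2) < γ)
    (ht₁ : 0 ≤ t₁) (ht₁T : t₁ < X.T) (hU : ContDiff ℝ 3 U) (hdiv : VectorCalculus.IsDivFree U)
    (heq : ∀ t ∈ Ioo t₁ X.T, ∀ x, X.u t x = selfSimilarCollapse γ X.T U t x) : False := by
  have hU0 := X.profile_eq_zero_of_eq_selfSimilarCollapse hν hγ hγ' ht₁ ht₁T hU hdiv heq
  obtain ⟨tm, htm1, htmT⟩ := exists_between ht₁T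
  obtain ⟨B, hB⟩ := X.exists_norm_le hν htmT
  refine X.velocity_unbounded hν ⟨max B 0, fun t ht x => ?_⟩
  rcases le_or_gt t tm with htle | htgt
  · exact (hB t ⟨ht.1, htle⟩ x).trans (le_max_left _ _)
  · have h0 : X.u t x = 0 := by
      rw [heq t ⟨htm1.trans htgt, ht.2⟩ x, hU0, selfSimilarCollapse_zero]
      rfl
    rw [h0, norm_zero]
    exact le_max_right _ _

end ClayBlowup

/-- **NO DESIGNED FORCED BLOW-UP IS AN EXACT COLLAPSE ANSATZ (`γ ≠ ½`) NEAR ITS BLOW-UP TIME** — the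
contradiction form on the strong type (g4 had «not unbounded on compact boxes»). `ν > 0`; no named
fact. [cite: FeffermanClay2006, (C) (5)] -/
theorem DesignedBlowup.false_of_eq_selfSimilarCollapse {ν γ t₁ : ℝ} (D : DesignedBlowup ν)
    {U : EuclideanSpace ℝ (Fin 3) → EuclideanSpace ℝ (Fin 3)} (hν : 0 < ν) (hγ : γ ≠ 1 / 2)
    (hγ' : -(1 / 2) < γ) (ht₁ : 0 ≤ t₁) (ht₁T : t₁ < D.T) (hU : ContDiff ℝ 3 U)
    (hdiv : VectorCalculus.IsDivFree U)
    (heq : ∀ t ∈ Ioo t₁ D.T, ∀ x, D.u t x = selfSimilarCollapse γ D.T U t x) : False :=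
  D.toClayBlowup.false_of_eq_selfSimilarCollapse hν hγ hγ' ht₁ ht₁T hU hdiv heq

end Summit.NavierStokesRegularity.FluidComputer

end
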